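/-
Copyright (c) 2026 the pub-hodgecm-mathlib formalisation cell (harness21).  Prover seat hodgecm-mathlib-K2Liu-p12 (g6), Track B «K2-LIT»,
#184♮ = hLiu418 = `stmt-HodgeConjecture-24832`; #42S block D, row D-2, (σ-A) mini-road ((σ-A) road desk K2Liu-p25 (g3) WORD #25∕#26: brick (an-3c-charts)),
FILE 1∕2 «QUADRATIC-COORDINATE MULTIPLICATION: ANISOTROPY OF THE NORM FORM AT A NON-SPLIT PLACE».  THEOREMS ONLY (no `def`, no `instance`, no `notation`, no named-fact hypothesis, no `sorry`).
-/
import Literature.NumberTheory.LocalFields.CompleteValuedSquareRootNearOne   -- ★ `isSquare_of_valued_sub_one_lt_four_adicCompletion` (Hensel: squares near `1`)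
import Literature.NumberTheory.Automorphic.AddCharConductorExponent          -- ★ `primePowBall` kit at `K_v`: `normAbs_le_normAbs_iff_valued`, `exists_normAbs_eq_inv_zpow`
import Mathlib.LinearAlgebra.Matrix.Determinant.Basic
import HarnessLib

/-!
# Crux `HLiu418`, socket #42S block D (row D-2, (σ-A) mini-road), brick (an-3c-charts) FILE 1∕2 `K2LiuQuadraticCoordinateMultiplication`:
# THE NORM FORM `a² − d·b²` OF A NON-SPLIT PLACE IS ANISOTROPIC WITH AN EXPLICIT CONSTANT: `|4|·max(|a|², |d|·|b|²) ≤ |a² − d·b²|`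

Cell `hodgecm-mathlib`, crux item hLiu418 = `stmt-HodgeConjecture-24832`; squad K2 ∕ K2Liu, road `K2_Liu`, socket #42S, block D row D-2; (σ-A) mini-road brick
(an-3c-charts) (the concrete `E_w`-multiplication graph `ζ ↦ ζ·s`, its max-coordinate charts and adapted frames for (an-3c) `K2LiuStageFunctionalConeWord`
(K2Liu-p08)).  Lane `--supports stmt-HodgeConjecture-24832 --as helper` (count-neutral helper; closes no socket by itself).

WHY.  The ζ-stage engine ★ p864380 (an-2) and the vertex Fubini 📤 (an-3b) `K2LiuConeVertexFubini` need, for the CONCRETE `Z_s : ζ ↦ ζ·s` (multiplication of the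
`E_w`-coordinates of the cone variable `s` by `ζ ∈ E_w`, read in the quadratic coordinates `{1, δ}` of `E_w = L⁺_v(δ)`, `δ² = d`), two size letters:
(ii) the `2 × 2` minor of `Z_s` at an `E_w`-coordinate `s_j = x + yδ` is `!![x, d·y; y, x]`, determinant `x² − d·y² = N(s_j)`, and `|N(s_j)|⁻¹ ≲ q^{2·level}`;
(iii) `ζ·s_j` small ⇒ `ζ` small by the level of `s_j` (the `hZ` letter of 📤 (an-3b) `fibreMass_box_le`).  Both are the ANISOTROPY of the norm form of the
quadratic extension `L_w ∕ L⁺_v` at a NON-SPLIT place (`d` not a square in `L⁺_v`), with an explicit constant: THIS FILE, at `K_v := v.adicCompletion K` for any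
number field `K` and finite place `v` (the record: `K := L⁺`), in the tree's `normAbs`∕`primePowBall` currency.
* §1 `K_v` bookkeeping: `normAbs_natCast_le_one`, `normAbs_add_eq_of_lt` (`|y| < |x| ⇒ |x + y| = |x|`), `normAbs_lt_normAbs_iff_valued`.
* §2 **`four_mul_max_le_normAbs_sq_sub_mul_sq`** — for `d` NOT a square: `|4|·max(|a|², |d|·|b|²) ≤ |a² − d b²|` (if `|a²| ≠ |d b²|` the ultrametric equality gives
  `max` itself; if `|a²| = |d b²|` then `w := a²∕(d b²)` is a unit that is NOT a square, so `|w − 1| ≥ |4|` by ★ Hensel `isSquare_of_valued_sub_one_lt_four_adicCompletion`);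
  and the trivial upper bound `normAbs_sq_sub_mul_sq_le_max`.
* §3 the multiplication word in quadratic coordinates: `(α + βδ)(x + yδ) = (αx + dβy) + (αy + βx)δ`, Brahmagupta `N(ζ·s) = N(ζ)·N(s)`, the minor
  `det !![x, d*y; y, x] = x² − d y²`.
* §4 BOX LETTERS (constants `c₄`, `c_d` with `|4| = q^{−c₄}`, `|d| = q^{−c_d}`, `c₀ := c₄ + |c_d|`): `mem_primePowBall_of_normSq_mem_left∕right` (`N(a + bδ) ∈ 𝔭^{2n + c₀} ⇒
  a, b ∈ 𝔭^n`), **`zpow_le_normAbs_normSq_of_le_max`** (`q^{−ℓ} ≤ max(|x|,|y|) ⇒ q^{−(2ℓ + c₀)} ≤ |x² − d y²|` — the MINOR BOUND (ii)), and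
  **`mem_primePowBall_of_mul_mem`** (`αx + dβy, αy + βx ∈ 𝔭^K`, `q^{−ℓ} ≤ max(|x|,|y|)` ⇒ `α, β ∈ 𝔭^{K − ℓ − c₄ − 2|c_d|}` — the LOWER-BOUND LETTER (iii)).
FILE 2∕2 `K2LiuConeChartFrames` assembles these per max-coordinate chart into (an-3c)'s `(Zm, A, hA)` and (an-3b)'s `hZ`.
[cite: Serre1979, Ch. XIV §4] [cite: Omeara1963, §63B (63:1)–(63:3)] [cite: WeilBNT1967, Ch. II §2, Def. 2] [cite: KudlaRallis1994, §2 (2.10)–(2.12)]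
HONEST LABEL.  Count-neutral helper; it retires nothing by itself: `HC_CM` is proved only modulo the 7 printed citations (2 remaining named inputs:
hLiu418 = `stmt-HodgeConjecture-24832`, h413 = `stmt-HodgeConjecture-24833`) until rung 0 closes.

## References
* [Serre1979] J.-P. Serre, *Local Fields* (1979), Ch. XIV §4 (squares close to `1`: `1 + 4𝔭 ⊆ (K_v^×)²`).
* [Omeara1963] O. T. O'Meara, *Introduction to Quadratic Forms* (1963), §63B (63:1)–(63:3) (the norm form of a quadratic extension is anisotropic; unit square classes).
* [WeilBNT1967] A. Weil, *Basic Number Theory* (1967), Ch. II §2, Def. 2 (the balls `𝔭^n` and levels).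
* [KudlaRallis1994] S. Kudla, S. Rallis, *A regularized Siegel–Weil formula: the first term identity*, Ann. of Math. 140 (1994), §2 (2.10)–(2.12).
-/

set_option autoImplicit false
set_option linter.dupNamespace false -- the mandated namespace repeats `HodgeConjecture.HodgeConjecture`

noncomputable section

open scoped NNReal Matrix
open NumberField IsDedekindDomain
open Literature.NumberTheory.Automorphic
open Literature.NumberTheory.GaloisRepresentations Literature.NumberTheory.GaloisRepresentations.IsNonarchimedeanLocalField

namespace Summit.HodgeConjecture.HodgeConjecture.Cruxes.HLiu418.K2LiuQuadraticCoordinateMultiplication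

variable (K : Type) [Field K] [NumberField K] (v : HeightOneSpectrum (𝓞 K))

/-! ## §1 `K_v` bookkeeping -/

/-- `‖n‖ ≤ 1` for a natural number `n` in `K_v` (ultrametric induction). [cite: WeilBNT1967, Ch. II §2, Def. 2] -/
theorem normAbs_natCast_le_one (n : ℕ) : normAbs (v.adicCompletion K) ((n : v.adicCompletion K)) ≤ 1 := by
  induction n with
  | zero => simp
  | succ k ih =>
    rw [Nat.cast_succ]
    refine (normAbs_add_le_max _ _).trans (max_le ih ?_)
    rw [map_one]

/-- `‖x‖ < ‖y‖ ↔ |x|_v < |y|_v` on `K_v`. [cite: WeilBNT1967, Ch. II §2, Def. 2] -/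
theorem normAbs_lt_normAbs_iff_valued (x y : v.adicCompletion K) :
    normAbs (v.adicCompletion K) x < normAbs (v.adicCompletion K) y ↔ Valued.v x < Valued.v y := by
  rw [← not_le, ← not_le, normAbs_le_normAbs_iff_valued]

/-- the ultrametric EQUALITY: `‖y‖ < ‖x‖ ⇒ ‖x + y‖ = ‖x‖`. [cite: WeilBNT1967, Ch. II §2, Def. 2] -/
theorem normAbs_add_eq_of_lt {x y : v.adicCompletion K} (h : normAbs (v.adicCompletion K) y < normAbs (v.adicCompletion K) x) :
    normAbs (v.adicCompletion K) (x + y) = normAbs (v.adicCompletion K) x := by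
  refine le_antisymm ((normAbs_add_le_max x y).trans (max_le le_rfl h.le)) ?_
  -- `‖x‖ = ‖(x + y) + (−y)‖ ≤ max ‖x + y‖ ‖y‖`, and `‖y‖ < ‖x‖`
  have h1 : normAbs (v.adicCompletion K) x ≤ max (normAbs (v.adicCompletion K) (x + y)) (normAbs (v.adicCompletion K) y) := by
    have h2 := normAbs_add_le_max (x + y) (-y)
    rwa [add_neg_cancel_right, normAbs_neg] at h2
  rcases le_max_iff.1 h1 with h3 | h3
  · exact h3
  · exact absurd h3 (not_le.2 h)

/-- `‖x − 1‖ = max ‖x‖ 1` when `‖x‖ ≠ 1`. [cite: WeilBNT1967, Ch. II §2, Def. 2] -/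
theorem normAbs_sub_one_eq_max_of_ne {x : v.adicCompletion K} (h : normAbs (v.adicCompletion K) x ≠ 1) :
    normAbs (v.adicCompletion K) (x - 1) = max (normAbs (v.adicCompletion K) x) 1 := by
  rcases lt_or_gt_of_ne h with hlt | hgt
  · rw [max_eq_right hlt.le, sub_eq_add_neg, add_comm, normAbs_add_eq_of_lt K v (by rwa [normAbs_neg, map_one]), normAbs_neg, map_one]
  · rw [max_eq_left hgt.le, sub_eq_add_neg, normAbs_add_eq_of_lt K v (by rwa [normAbs_neg, map_one])]

/-! ## §2 Anisotropy of the norm form `a² − d·b²` for `d` not a square -/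

/-- `d ≠ 0` if `d` is not a square. [cite: Omeara1963, §63B (63:1)] -/
theorem ne_zero_of_not_isSquare {d : v.adicCompletion K} (hd : ¬ IsSquare d) : d ≠ 0 := by
  rintro rfl
  exact hd IsSquare.zero

/-- **Hensel step**: a unit that is not a square is far from `1` — `‖w‖ = 1`, `¬ IsSquare w` ⇒ `‖4‖ ≤ ‖w − 1‖`
(★ `isSquare_of_valued_sub_one_lt_four_adicCompletion`). [cite: Serre1979, Ch. XIV §4] -/
theorem normAbs_four_le_normAbs_sub_one_of_not_isSquare {w : v.adicCompletion K} (hw : ¬ IsSquare w) :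
    normAbs (v.adicCompletion K) (4 : v.adicCompletion K) ≤ normAbs (v.adicCompletion K) (w - 1) := by
  by_contra hlt
  rw [not_le, normAbs_lt_normAbs_iff_valued] at hlt
  exact hw (Literature.NumberTheory.LocalFields.isSquare_of_valued_sub_one_lt_four_adicCompletion K v w hlt)

/-- **ANISOTROPY OF THE NORM FORM AT A NON-SPLIT PLACE.**  If `d ∈ K_v` is NOT a square then for all `a b`:
`‖4‖ · max (‖a‖², ‖d‖·‖b‖²) ≤ ‖a² − d·b²‖` — the norm form of `K_v(√d) ∕ K_v` does not cancel beyond the factor `‖4‖` (`= 1` off the dyadic places).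
Proof: `b = 0` is trivial; else `a² − d b² = d b² (w − 1)`, `w := a²∕(d b²)`; if `‖w‖ ≠ 1` the ultrametric equality gives `‖w − 1‖ = max(‖w‖, 1)`; if `‖w‖ = 1` then
`w` is not a square (else `d = (a∕(b r))²`), so `‖w − 1‖ ≥ ‖4‖` by Hensel. [cite: Omeara1963, §63B (63:1)–(63:3)] [cite: Serre1979, Ch. XIV §4] -/
theorem four_mul_max_le_normAbs_sq_sub_mul_sq {d : v.adicCompletion K} (hd : ¬ IsSquare d) (a b : v.adicCompletion K) :
    normAbs (v.adicCompletion K) (4 : v.adicCompletion K) *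
        max (normAbs (v.adicCompletion K) a ^ 2) (normAbs (v.adicCompletion K) d * normAbs (v.adicCompletion K) b ^ 2) ≤
      normAbs (v.adicCompletion K) (a ^ 2 - d * b ^ 2) := by
  have h4 : normAbs (v.adicCompletion K) (4 : v.adicCompletion K) ≤ 1 := by
    have h := normAbs_natCast_le_one K v 4
    rwa [Nat.cast_ofNat] at h
  have hd0 : d ≠ 0 := ne_zero_of_not_isSquare K v hd
  by_cases hb : b = 0
  · subst hb
    simp only [map_zero, zero_pow two_ne_zero, mul_zero, sub_zero, map_pow]
    rw [max_eq_left zero_le]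
    exact mul_le_of_le_one_left zero_le h4
  -- `b ≠ 0`: factor `a² − d b² = (d b²) (w − 1)`
  set w : v.adicCompletion K := a ^ 2 * (d * b ^ 2)⁻¹ with hw
  have hdb : d * b ^ 2 ≠ 0 := mul_ne_zero hd0 (pow_ne_zero 2 hb)
  have hfac : a ^ 2 - d * b ^ 2 = d * b ^ 2 * (w - 1) := by
    rw [hw]; field_simp
  have hwv : normAbs (v.adicCompletion K) w * (normAbs (v.adicCompletion K) d * normAbs (v.adicCompletion K) b ^ 2) =
      normAbs (v.adicCompletion K) a ^ 2 := by
    rw [← map_pow, ← map_pow, ← map_mul, ← map_mul, hw, inv_mul_cancel_right₀ hdb]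
  rw [hfac, map_mul, map_mul, map_pow]
  by_cases h1 : normAbs (v.adicCompletion K) w = 1
  · -- `‖a²‖ = ‖d b²‖`, and `w` is a non-square unit: `‖w − 1‖ ≥ ‖4‖`
    have hmax : max (normAbs (v.adicCompletion K) a ^ 2) (normAbs (v.adicCompletion K) d * normAbs (v.adicCompletion K) b ^ 2) =
        normAbs (v.adicCompletion K) d * normAbs (v.adicCompletion K) b ^ 2 := by
      rw [← hwv, h1, one_mul, max_self]
    have hwsq : ¬ IsSquare w := by
      rintro ⟨r, hr⟩
      have hr0 : r ≠ 0 := by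
        rintro rfl
        rw [mul_zero] at hr
        rw [hr, map_zero] at h1
        exact zero_ne_one h1
      apply hd
      refine ⟨a * (b * r)⁻¹, ?_⟩
      have h2 : a ^ 2 = d * b ^ 2 * (r * r) := by rw [← hr, hw]; field_simp
      have hbr : (b * r) ^ 2 ≠ 0 := pow_ne_zero 2 (mul_ne_zero hb hr0)
      rw [show a * (b * r)⁻¹ * (a * (b * r)⁻¹) = a ^ 2 * ((b * r) ^ 2)⁻¹ by ring, h2,
        show d * b ^ 2 * (r * r) * ((b * r) ^ 2)⁻¹ = d * ((b * r) ^ 2 * ((b * r) ^ 2)⁻¹) by ring,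
        mul_inv_cancel₀ hbr, mul_one]
    rw [hmax, mul_comm (normAbs (v.adicCompletion K) (4 : v.adicCompletion K))]
    exact mul_le_mul_of_nonneg_left (normAbs_four_le_normAbs_sub_one_of_not_isSquare K v hwsq) zero_le
  · -- `‖w‖ ≠ 1`: `‖w − 1‖ = max ‖w‖ 1`, so `‖a² − d b²‖ = max(‖a‖², ‖d‖‖b‖²)`
    have hR : normAbs (v.adicCompletion K) d * normAbs (v.adicCompletion K) b ^ 2 * max (normAbs (v.adicCompletion K) w) 1 =
        max (normAbs (v.adicCompletion K) a ^ 2) (normAbs (v.adicCompletion K) d * normAbs (v.adicCompletion K) b ^ 2) := by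
      rw [mul_comm, max_mul_of_nonneg _ _ zero_le, one_mul, hwv]
    rw [normAbs_sub_one_eq_max_of_ne K v h1, hR]
    exact mul_le_of_le_one_left zero_le h4

/-- the trivial upper bound `‖a² − d·b²‖ ≤ max (‖a‖², ‖d‖·‖b‖²)`. [cite: WeilBNT1967, Ch. II §2, Def. 2] -/
theorem normAbs_sq_sub_mul_sq_le_max (d a b : v.adicCompletion K) :
    normAbs (v.adicCompletion K) (a ^ 2 - d * b ^ 2) ≤
      max (normAbs (v.adicCompletion K) a ^ 2) (normAbs (v.adicCompletion K) d * normAbs (v.adicCompletion K) b ^ 2) := by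
  have h := normAbs_add_le_max (a ^ 2) (-(d * b ^ 2))
  rwa [← sub_eq_add_neg, normAbs_neg, map_pow, map_mul, map_pow] at h

/-! ## §3 The multiplication word in quadratic coordinates -/

/-- Brahmagupta: `N((α + βδ)(x + yδ)) = N(α + βδ)·N(x + yδ)` in the coordinates `(αx + dβy, αy + βx)` of the product (`δ² = d`). [cite: Omeara1963, §63B (63:1)] -/
theorem normSq_mul (d α β x y : v.adicCompletion K) :
    (α * x + d * β * y) ^ 2 - d * (α * y + β * x) ^ 2 = (α ^ 2 - d * β ^ 2) * (x ^ 2 - d * y ^ 2) := by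
  ring

/-- the `2 × 2` minor of `ζ ↦ ζ·(x + yδ)` in the coordinates `ζ = α + βδ ↦ (α, β)`: the matrix `!![x, d*y; y, x]` (`(α,β) ↦ (αx + dβy, αy + βx)`) has
determinant `x² − d·y² = N(x + yδ)`. [cite: Omeara1963, §63B (63:1)] -/
theorem det_mulMatrix (d x y : v.adicCompletion K) : (!![x, d * y; y, x] : Matrix (Fin 2) (Fin 2) (v.adicCompletion K)).det = x ^ 2 - d * y ^ 2 := by
  rw [Matrix.det_fin_two_of]
  ring

/-- the matrix acts as the multiplication word: `!![x, d*y; y, x] *ᵥ ![α, β] = ![αx + dβy, αy + βx]`. [cite: Omeara1963, §63B (63:1)] -/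
theorem mulMatrix_mulVec (d x y α β : v.adicCompletion K) :
    (!![x, d * y; y, x] : Matrix (Fin 2) (Fin 2) (v.adicCompletion K)) *ᵥ ![α, β] = ![α * x + d * β * y, α * y + β * x] := by
  ext i
  fin_cases i <;> simp [Matrix.mulVec, dotProduct, Fin.sum_univ_two] <;> ring

/-! ## §4 Box letters: norms control coordinates with the explicit constant `c₀ = c₄ + |c_d|` -/

section Boxes

variable {d : v.adicCompletion K} (hd : ¬ IsSquare d) {c₄ cd : ℤ}
  (h4 : normAbs (v.adicCompletion K) (4 : v.adicCompletion K) = (residueFieldCard (v.adicCompletion K) : ℝ≥0)⁻¹ ^ c₄)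
  (hdv : normAbs (v.adicCompletion K) d = (residueFieldCard (v.adicCompletion K) : ℝ≥0)⁻¹ ^ cd)

/-- the constant letters exist: `‖4‖ = q^{−c₄}` with `0 ≤ c₄` (`‖4‖ ≤ 1`, `4 ≠ 0`). [cite: WeilBNT1967, Ch. II §2, Def. 2] -/
theorem exists_normAbs_four_eq : ∃ c₄ : ℤ, 0 ≤ c₄ ∧
    normAbs (v.adicCompletion K) (4 : v.adicCompletion K) = (residueFieldCard (v.adicCompletion K) : ℝ≥0)⁻¹ ^ c₄ := by
  haveI : CharZero (v.adicCompletion K) := charZero_of_injective_algebraMap (algebraMap K (v.adicCompletion K)).injective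
  obtain ⟨k, hk⟩ := exists_normAbs_eq_inv_zpow (F := v.adicCompletion K) (x := 4) (by norm_num)
  refine ⟨k, ?_, hk⟩
  by_contra hneg
  rw [not_le] at hneg
  have h1 : (1 : ℝ≥0) < (residueFieldCard (v.adicCompletion K) : ℝ≥0)⁻¹ ^ k := by
    simpa using zpow_lt_zpow_right_of_lt_one₀ inv_residueFieldCard_pos inv_residueFieldCard_lt_one hneg
  have h := normAbs_natCast_le_one K v 4
  rw [Nat.cast_ofNat, hk] at h
  exact absurd (h1.trans_le h) (lt_irrefl _)

include hd in
/-- `‖d‖ = q^{−c_d}` for some `c_d` (`d ≠ 0`). [cite: WeilBNT1967, Ch. II §2, Def. 2] -/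
theorem exists_normAbs_eq_of_not_isSquare : ∃ cd : ℤ, normAbs (v.adicCompletion K) d = (residueFieldCard (v.adicCompletion K) : ℝ≥0)⁻¹ ^ cd :=
  exists_normAbs_eq_inv_zpow (ne_zero_of_not_isSquare K v hd)

include hd h4 in
/-- **`N ∈ 𝔭^{2n + c₄} ⇒ a ∈ 𝔭^n`**: the first coordinate is controlled by the norm. [cite: Omeara1963, §63B (63:1)–(63:3)] -/
theorem mem_primePowBall_of_normSq_mem_left {a b : v.adicCompletion K} {n : ℤ}
    (h : a ^ 2 - d * b ^ 2 ∈ primePowBall (v.adicCompletion K) (2 * n + c₄)) : a ∈ primePowBall (v.adicCompletion K) n := by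
  have hq0 : (residueFieldCard (v.adicCompletion K) : ℝ≥0)⁻¹ ≠ 0 := inv_residueFieldCard_pos.ne'
  have hA := four_mul_max_le_normAbs_sq_sub_mul_sq K v hd a b
  rw [mem_primePowBall_iff] at h ⊢
  have h1 : normAbs (v.adicCompletion K) (4 : v.adicCompletion K) * normAbs (v.adicCompletion K) a ^ 2 ≤
      (residueFieldCard (v.adicCompletion K) : ℝ≥0)⁻¹ ^ (2 * n + c₄) :=
    ((mul_le_mul_of_nonneg_left (le_max_left _ _) zero_le).trans hA).trans h
  rw [h4, zpow_add₀ hq0, mul_comm ((residueFieldCard (v.adicCompletion K) : ℝ≥0)⁻¹ ^ (2 * n)), mul_comm (2 : ℤ) n, zpow_mul] at h1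
  have h2 : normAbs (v.adicCompletion K) a ^ 2 ≤ (((residueFieldCard (v.adicCompletion K) : ℝ≥0)⁻¹ ^ n) ^ (2 : ℤ)) :=
    le_of_mul_le_mul_left h1 (zpow_pos inv_residueFieldCard_pos c₄)
  rw [zpow_ofNat] at h2
  exact (pow_le_pow_iff_left₀ zero_le zero_le two_ne_zero).1 h2

include hd h4 hdv in
/-- **`N ∈ 𝔭^{2n + c₄ + c_d} ⇒ b ∈ 𝔭^n`**: the second coordinate is controlled by the norm. [cite: Omeara1963, §63B (63:1)–(63:3)] -/
theorem mem_primePowBall_of_normSq_mem_right {a b : v.adicCompletion K} {n : ℤ}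
    (h : a ^ 2 - d * b ^ 2 ∈ primePowBall (v.adicCompletion K) (2 * n + c₄ + cd)) : b ∈ primePowBall (v.adicCompletion K) n := by
  have hq0 : (residueFieldCard (v.adicCompletion K) : ℝ≥0)⁻¹ ≠ 0 := inv_residueFieldCard_pos.ne'
  have hA := four_mul_max_le_normAbs_sq_sub_mul_sq K v hd a b
  rw [mem_primePowBall_iff] at h ⊢
  have h1 : normAbs (v.adicCompletion K) (4 : v.adicCompletion K) * (normAbs (v.adicCompletion K) d * normAbs (v.adicCompletion K) b ^ 2) ≤
      (residueFieldCard (v.adicCompletion K) : ℝ≥0)⁻¹ ^ (2 * n + c₄ + cd) :=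
    ((mul_le_mul_of_nonneg_left (le_max_right _ _) zero_le).trans hA).trans h
  rw [h4, hdv, ← mul_assoc, ← zpow_add₀ hq0, show 2 * n + c₄ + cd = (c₄ + cd) + n * 2 by ring, zpow_add₀ hq0 (c₄ + cd) (n * 2), zpow_mul] at h1
  have h2 : normAbs (v.adicCompletion K) b ^ 2 ≤ (((residueFieldCard (v.adicCompletion K) : ℝ≥0)⁻¹ ^ n) ^ (2 : ℤ)) :=
    le_of_mul_le_mul_left h1 (zpow_pos inv_residueFieldCard_pos _)
  rw [zpow_ofNat] at h2
  exact (pow_le_pow_iff_left₀ zero_le zero_le two_ne_zero).1 h2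

include hd h4 hdv in
/-- **THE MINOR BOUND (ii).**  If the pair `(x, y)` has size at least `q^{−ℓ}` (`q^{−ℓ} ≤ max ‖x‖ ‖y‖`, i.e. level `≤ ℓ`) then
`q^{−(2ℓ + c₄ + |c_d|)} ≤ ‖x² − d·y²‖` — the determinant `N(x + yδ)` of the minor `!![x, d*y; y, x]` is bounded BELOW by the square of the size, up to the fixed constant
`c₀ = c₄ + |c_d|`. [cite: Omeara1963, §63B (63:1)–(63:3)] [cite: KudlaRallis1994, §2 (2.10)–(2.12)] -/
theorem zpow_le_normAbs_normSq_of_le_max {x y : v.adicCompletion K} {ℓ : ℤ}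
    (hxy : (residueFieldCard (v.adicCompletion K) : ℝ≥0)⁻¹ ^ ℓ ≤ max (normAbs (v.adicCompletion K) x) (normAbs (v.adicCompletion K) y)) :
    (residueFieldCard (v.adicCompletion K) : ℝ≥0)⁻¹ ^ (2 * ℓ + c₄ + |cd|) ≤ normAbs (v.adicCompletion K) (x ^ 2 - d * y ^ 2) := by
  set r : ℝ≥0 := (residueFieldCard (v.adicCompletion K) : ℝ≥0)⁻¹ with hr
  have hr0 : r ≠ 0 := inv_residueFieldCard_pos.ne'
  have hrpos : 0 < r := inv_residueFieldCard_pos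
  have hr1 : r ≤ 1 := inv_residueFieldCard_lt_one.le
  refine le_trans ?_ (four_mul_max_le_normAbs_sq_sub_mul_sq K v hd x y)
  -- `r ^ |c_d| ≤ 1` and `r ^ |c_d| ≤ r ^ c_d = ‖d‖`
  have hcd1 : r ^ (|cd| : ℤ) ≤ 1 := zpow_le_one₀ hrpos hr1 (abs_nonneg cd)
  have hcdd : r ^ (|cd| : ℤ) ≤ r ^ cd := zpow_le_zpow_right_of_le_one₀ hrpos hr1 (le_abs_self cd)
  rw [h4, hdv, show 2 * ℓ + c₄ + |cd| = c₄ + (|cd| + ℓ * 2) by ring, zpow_add₀ hr0 c₄ (|cd| + ℓ * 2), zpow_add₀ hr0 (|cd|) (ℓ * 2),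
    zpow_mul, zpow_ofNat]
  refine mul_le_mul_of_nonneg_left ?_ zero_le
  -- `r^{|c_d|} · (r^ℓ)² ≤ max (‖x‖², ‖d‖ ‖y‖²)`
  rcases le_max_iff.1 hxy with hx | hy
  · refine le_trans ?_ (le_max_left _ _)
    calc r ^ (|cd| : ℤ) * (r ^ ℓ) ^ 2 ≤ 1 * (r ^ ℓ) ^ 2 := mul_le_mul_of_nonneg_right hcd1 zero_le
      _ = (r ^ ℓ) ^ 2 := one_mul _
      _ ≤ normAbs (v.adicCompletion K) x ^ 2 := pow_le_pow_left₀ zero_le hx 2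
  · refine le_trans ?_ (le_max_right _ _)
    calc r ^ (|cd| : ℤ) * (r ^ ℓ) ^ 2 ≤ r ^ cd * (r ^ ℓ) ^ 2 := mul_le_mul_of_nonneg_right hcdd zero_le
      _ ≤ r ^ cd * normAbs (v.adicCompletion K) y ^ 2 := mul_le_mul_of_nonneg_left (pow_le_pow_left₀ zero_le hy 2) zero_le

include hd h4 hdv in
/-- **THE LOWER-BOUND LETTER (iii).**  If the product `(α + βδ)(x + yδ)` lies in the box `(𝔭^{Kx})²` — both coordinates `αx + dβy`, `αy + βx ∈ 𝔭^{Kx}` — and the pair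
`(x, y)` has size at least `q^{−ℓ}`, then `α, β ∈ 𝔭^{Kx − ℓ − (c₄ + 2|c_d|)}`: multiplying by a vector of level `ℓ` can shrink a box by at most `ℓ + c₄ + 2|c_d|` steps.
(Brahmagupta `N(ζ s) = N(ζ) N(s)`, the upper bound on `N(ζ s)`, the minor bound on `N(s)`, then the coordinate letters on `N(ζ)`.)
[cite: Omeara1963, §63B (63:1)–(63:3)] [cite: KudlaRallis1994, §2 (2.10)–(2.12)] -/
theorem mem_primePowBall_of_mul_mem {α β x y : v.adicCompletion K} {Kx ℓ : ℤ}
    (hxy : (residueFieldCard (v.adicCompletion K) : ℝ≥0)⁻¹ ^ ℓ ≤ max (normAbs (v.adicCompletion K) x) (normAbs (v.adicCompletion K) y))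
    (h1 : α * x + d * β * y ∈ primePowBall (v.adicCompletion K) Kx) (h2 : α * y + β * x ∈ primePowBall (v.adicCompletion K) Kx) :
    α ∈ primePowBall (v.adicCompletion K) (Kx - ℓ - (c₄ + 2 * |cd|)) ∧ β ∈ primePowBall (v.adicCompletion K) (Kx - ℓ - (c₄ + 2 * |cd|)) := by
  set r : ℝ≥0 := (residueFieldCard (v.adicCompletion K) : ℝ≥0)⁻¹ with hr
  have hr0 : r ≠ 0 := inv_residueFieldCard_pos.ne'
  have hrpos : 0 < r := inv_residueFieldCard_pos
  have hr1 : r ≤ 1 := inv_residueFieldCard_lt_one.le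
  rw [mem_primePowBall_iff] at h1 h2
  -- `‖N(ζ)‖ · ‖N(s)‖ = ‖N(ζ s)‖ ≤ max(‖p‖², ‖d‖ ‖q‖²) ≤ r^{−|c_d|} · (r^{Kx})²`
  have hcd1 : 1 ≤ r ^ (-|cd| : ℤ) := one_le_zpow_of_nonpos₀ hrpos hr1 (neg_nonpos.2 (abs_nonneg cd))
  have hcdd : normAbs (v.adicCompletion K) d ≤ r ^ (-|cd| : ℤ) := by
    rw [hdv]; exact zpow_le_zpow_right_of_le_one₀ hrpos hr1 (neg_abs_le cd)
  have hup : normAbs (v.adicCompletion K) ((α * x + d * β * y) ^ 2 - d * (α * y + β * x) ^ 2) ≤ r ^ (-|cd| : ℤ) * (r ^ Kx) ^ 2 := by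
    refine (normAbs_sq_sub_mul_sq_le_max K v d _ _).trans (max_le ?_ ?_)
    · calc normAbs (v.adicCompletion K) (α * x + d * β * y) ^ 2 ≤ (r ^ Kx) ^ 2 := pow_le_pow_left₀ zero_le h1 2
        _ = 1 * (r ^ Kx) ^ 2 := (one_mul _).symm
        _ ≤ r ^ (-|cd| : ℤ) * (r ^ Kx) ^ 2 := mul_le_mul_of_nonneg_right hcd1 zero_le
    · exact mul_le_mul hcdd (pow_le_pow_left₀ zero_le h2 2) zero_le zero_le
  rw [normSq_mul, map_mul] at hup
  -- divide by the minor bound `r^{2ℓ + c₄ + |c_d|} ≤ ‖N(s)‖`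
  have hlow := zpow_le_normAbs_normSq_of_le_max K v hd h4 hdv hxy
  have hNs_pos : 0 < normAbs (v.adicCompletion K) (x ^ 2 - d * y ^ 2) := lt_of_lt_of_le (zpow_pos hrpos _) hlow
  have hNζ : normAbs (v.adicCompletion K) (α ^ 2 - d * β ^ 2) ≤ r ^ (2 * (Kx - ℓ) - c₄ - 2 * |cd|) := by
    have h3 : normAbs (v.adicCompletion K) (α ^ 2 - d * β ^ 2) * r ^ (2 * ℓ + c₄ + |cd|) ≤ r ^ (-|cd| : ℤ) * (r ^ Kx) ^ 2 :=
      (mul_le_mul_of_nonneg_left hlow zero_le).trans hup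
    have h5 : r ^ (-|cd| : ℤ) * (r ^ Kx) ^ 2 = r ^ (2 * (Kx - ℓ) - c₄ - 2 * |cd|) * r ^ (2 * ℓ + c₄ + |cd|) := by
      rw [← zpow_natCast, ← zpow_mul, ← zpow_add₀ hr0, ← zpow_add₀ hr0]
      congr 1
      ring
    rw [h5] at h3
    exact le_of_mul_le_mul_right h3 (zpow_pos hrpos _)
  have hNζ' : α ^ 2 - d * β ^ 2 ∈ primePowBall (v.adicCompletion K) (2 * (Kx - ℓ) - c₄ - 2 * |cd|) := hNζ
  refine ⟨mem_primePowBall_of_normSq_mem_left K v hd h4 (primePowBall_antitone ?_ hNζ'),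
    mem_primePowBall_of_normSq_mem_right K v hd h4 hdv (primePowBall_antitone ?_ hNζ')⟩
  · linarith [abs_nonneg cd]
  · linarith [le_abs_self cd, abs_nonneg cd]

end Boxes

end Summit.HodgeConjecture.HodgeConjecture.Cruxes.HLiu418.K2LiuQuadraticCoordinateMultiplication

end
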